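import Summits.KontsevichZagierPeriods.KontsevichZagierPeriods.Theorems.HurwitzMicroSectorsNormalFormPrincipleSplitMoves
import Summits.KontsevichZagierPeriods.KontsevichZagierPeriods.Theorems.HurwitzMicroSectorsNormalFormPrincipleAlgDlogMoves
import Summits.KontsevichZagierPeriods.KontsevichZagierPeriods.Theorems.HurwitzMicroSectorsNormalFormPrincipleAlgBaker

/-!
# `NormalFormPrinciple` (stmt-KontsevichZagierPeriods-3869), stub `box_algsplit_mem_relations`
# (siege k5, Mathlib API route), I: the algebraic normal form `[pt, r] + Σᵢ Λ(εᵢ, Cᵢ)`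

Pure proof file (`--supports` the crux stmt-KontsevichZagierPeriods-3869). Towards the registered
sub-goal `box_algsplit_mem_relations` (BoxVanishing in dimension one for `ℚ`-polynomial denominators
all of whose roots are real algebraic) we fix the NORMAL FORM modulo `KZ.relations` used throughout:
for a family `ε : Fin s → ℝ` of real algebraic numbers `εᵢ > 1`, a formal combination `x` is in
normal form (abbreviated `NF(ε, x)` in the docstrings of this file only) if

  `x ≡ [pt, r] + Σᵢ Λ(εᵢ, Cᵢ)`  modulo `KZ.relations`,  `Λ(u, c) := [(1,u), c/y]`,

with REAL ALGEBRAIC `r, Cᵢ` (`[pt, r]` the point representation over `ℝ⁰`); formally the explicit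
existential

  `∃ r C Z L, IsAlgebraic ℚ r ∧ (∀ i, IsAlgebraic ℚ (C i)) ∧ Z = [pt, r] ∧ L i = [(1,εᵢ), Cᵢ/y] ∧`
  `x − of Z − Σᵢ of (L i) ∈ relations`,

written out in every statement. This file proves that the class of normal forms contains
`KZ.relations`, the point representations with algebraic constant and the basic carriers
`Λ(εᵢ, c)`, is closed under `+`, `−`, finite sums and `ℤ`-multiples (rules 1a/1b only), and — the
arithmetic endgame — that a normal form of VALUE ZERO is a relation when the `log εᵢ` are
`ℚ`-linearly independent (Baker's theorem in the torsion-free form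
`Dlog.eq_zero_of_alg_add_sum_mul_log_eq_zero` of `…AlgBaker.lean`: `r + Σ Cᵢ log εᵢ = 0` forces
`r = 0`, `Cᵢ = 0`, and zero integrands are relations).

Sources: M. Kontsevich, D. Zagier, *Periods* (2001), §1.2 rules (1)–(3); A. Baker, *Transcendental
Number Theory* (1975), Thm. 2.1. No definitions are introduced.
-/

noncomputable section

open MeasureTheory Set Finset
open Literature.NumberTheory.Transcendental Literature.NumberTheory.Transcendental.KZ
open Literature.ModelTheory.ExponentialFields (IsSemialgebraic isSemialgebraic_univ)

namespace Summit.KontsevichZagierPeriods.HurwitzMicroSectors.NormalFormPrinciple.PiBox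

namespace AlgSplitK5

open Dlog

/-! ## Existence of the pieces of a normal form -/

/-- The point representation `[pt, r]` over `ℝ⁰` with a real ALGEBRAIC constant `r` exists.
[cite: KontsevichZagier2001, §1.1] -/
theorem exists_ptA {r : ℝ} (hr : IsAlgebraic ℚ r) :
    ∃ Z : IntegralRep 0, Z.domain = Set.univ ∧ Z.integrand = fun _ => r :=
  ⟨{ domain := univ
     integrand := fun _ => r
     isSemialgebraic_domain := isSemialgebraic_univ
     isSemialgebraicFunOn_integrand :=
       isSemialgebraicFunOn_const_of_isAlgebraic isSemialgebraic_univ hr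
     integrableOn := integrableOn_const (hs := by simp [volume_univ_fin_zero]) }, rfl, rfl⟩

/-- The family of carriers `Λ(εᵢ, Cᵢ) = [(1, εᵢ), Cᵢ/y]` exists for real algebraic `εᵢ`, `Cᵢ`.
[cite: KontsevichZagier2001, §1.1] -/
theorem exists_carriers {s : ℕ} (ε : Fin s → ℝ) (hεalg : ∀ i, IsAlgebraic ℚ (ε i))
    (C : Fin s → ℝ) (hC : ∀ i, IsAlgebraic ℚ (C i)) :
    ∃ L : Fin s → IntegralRep 1, ∀ i, (L i).domain = {x : Fin 1 → ℝ | x 0 ∈ Set.Ioo 1 (ε i)} ∧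
      ((L i).integrand = fun x => C i / x 0) := by
  choose L hL using fun i => exists_dlogA isAlgebraic_one (hεalg i) (hC i) one_pos
  exact ⟨L, hL⟩

/-- A carrier with zero constant is a relation. [cite: KontsevichZagier2001, §1.2 rule (1)] -/
theorem carrier_zero_mem_relations (L : IntegralRep 1) (hLi : L.integrand = fun x => (0:ℝ) / x 0) :
    of L ∈ relations :=
  dlogA_zero_mem_relations L (by rw [hLi]; exact fun _ _ => rfl)

/-- A finite sum of members of `relations` is a relation. [folklore] -/
theorem sum_mem_relations {ι : Type*} (t : Finset ι) (f : ι → FormalRep)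
    (h : ∀ i ∈ t, f i ∈ relations) : ∑ i ∈ t, f i ∈ relations :=
  AddSubgroup.sum_mem _ h

/-! ## The normal form: closure properties -/

/-- Relations are in normal form with zero data: if `x ∈ relations` then
`x − [pt, 0] − Σᵢ Λ(εᵢ, 0) ∈ relations`. [cite: KontsevichZagier2001, §1.2 rule (1)] -/
theorem nf_data_of_mem_relations {s : ℕ} {ε : Fin s → ℝ} {x : FormalRep} (hx : x ∈ relations)
    (Z : IntegralRep 0) (hZi : Z.integrand = fun _ => (0:ℝ)) (L : Fin s → IntegralRep 1)
    (hL : ∀ i, (L i).domain = {x : Fin 1 → ℝ | x 0 ∈ Set.Ioo 1 (ε i)} ∧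
      ((L i).integrand = fun x => (0:ℝ) / x 0)) :
    x - of Z - ∑ i, of (L i) ∈ relations :=
  relations.sub_mem (relations.sub_mem hx (pt_zero_mem_relations Z hZi))
    (sum_mem_relations _ _ fun i _ => carrier_zero_mem_relations (L i) (hL i).2)

/-- **Additivity of normal forms** (rule 1b on the point and on each carrier): from
`x ≡ [pt,r] + Σ Λ(εᵢ,Cᵢ)` and `y ≡ [pt,r'] + Σ Λ(εᵢ,C'ᵢ)` follows
`x + y ≡ [pt, r+r'] + Σ Λ(εᵢ, Cᵢ+C'ᵢ)`. [cite: KontsevichZagier2001, §1.2 rule (1)] -/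
theorem nf_data_add {s : ℕ} {ε : Fin s → ℝ} {x y : FormalRep} {r r' : ℝ} {C C' : Fin s → ℝ}
    (Z Z' Z'' : IntegralRep 0) (hZd : Z.domain = Set.univ) (hZi : Z.integrand = fun _ => r)
    (hZ'd : Z'.domain = Set.univ) (hZ'i : Z'.integrand = fun _ => r')
    (hZ''d : Z''.domain = Set.univ) (hZ''i : Z''.integrand = fun _ => r + r')
    (L L' L'' : Fin s → IntegralRep 1)
    (hL : ∀ i, (L i).domain = {x : Fin 1 → ℝ | x 0 ∈ Set.Ioo 1 (ε i)} ∧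
      ((L i).integrand = fun x => C i / x 0))
    (hL' : ∀ i, (L' i).domain = {x : Fin 1 → ℝ | x 0 ∈ Set.Ioo 1 (ε i)} ∧
      ((L' i).integrand = fun x => C' i / x 0))
    (hL'' : ∀ i, (L'' i).domain = {x : Fin 1 → ℝ | x 0 ∈ Set.Ioo 1 (ε i)} ∧
      ((L'' i).integrand = fun x => (C i + C' i) / x 0))
    (hx : x - of Z - ∑ i, of (L i) ∈ relations) (hy : y - of Z' - ∑ i, of (L' i) ∈ relations) :
    x + y - of Z'' - ∑ i, of (L'' i) ∈ relations := by
  have hZ : of Z'' - of Z - of Z' ∈ relations :=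
    pt_add_mem_relations Z'' Z Z' hZ''d hZd hZ'd hZ''i hZi hZ'i
  have hLi : ∀ i, of (L'' i) - of (L i) - of (L' i) ∈ relations := fun i =>
    dlogA_merge_mem_relations (L'' i) (L i) (L' i) (hL'' i).1 (hL i).1 (hL' i).1
      (by rw [(hL'' i).2]; exact fun _ _ => rfl) (by rw [(hL i).2]; exact fun _ _ => rfl)
      (by rw [(hL' i).2]; exact fun _ _ => rfl)
  have hsum : ∑ i, (of (L'' i) - of (L i) - of (L' i)) ∈ relations :=
    sum_mem_relations _ _ fun i _ => hLi i
  have : x + y - of Z'' - ∑ i, of (L'' i) = (x - of Z - ∑ i, of (L i)) +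
      (y - of Z' - ∑ i, of (L' i)) - (of Z'' - of Z - of Z') -
      ∑ i, (of (L'' i) - of (L i) - of (L' i)) := by
    simp only [Finset.sum_sub_distrib]
    abel
  rw [this]
  exact relations.sub_mem (relations.sub_mem (relations.add_mem hx hy) hZ) hsum

/-- **Negation of normal forms**: from `x ≡ [pt,r] + Σ Λ(εᵢ,Cᵢ)` follows
`−x ≡ [pt,−r] + Σ Λ(εᵢ,−Cᵢ)` (a representation plus its negative is a relation).
[cite: KontsevichZagier2001, §1.2 rule (1)] -/
theorem nf_data_neg {s : ℕ} {ε : Fin s → ℝ} {x : FormalRep} {r : ℝ} {C : Fin s → ℝ}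
    (Z Z' : IntegralRep 0) (hZd : Z.domain = Set.univ) (hZi : Z.integrand = fun _ => r)
    (hZ'd : Z'.domain = Set.univ) (hZ'i : Z'.integrand = fun _ => -r)
    (L L' : Fin s → IntegralRep 1)
    (hL : ∀ i, (L i).domain = {x : Fin 1 → ℝ | x 0 ∈ Set.Ioo 1 (ε i)} ∧
      ((L i).integrand = fun x => C i / x 0))
    (hL' : ∀ i, (L' i).domain = {x : Fin 1 → ℝ | x 0 ∈ Set.Ioo 1 (ε i)} ∧
      ((L' i).integrand = fun x => (-C i) / x 0))
    (hx : x - of Z - ∑ i, of (L i) ∈ relations) :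
    -x - of Z' - ∑ i, of (L' i) ∈ relations := by
  have hZ : of Z + of Z' ∈ relations :=
    of_add_of_mem_relations_of_eqOn_neg (hZ'd.trans hZd.symm) fun z _ => by simp [hZi, hZ'i]
  have hLi : ∀ i, of (L i) + of (L' i) ∈ relations := fun i =>
    of_add_of_mem_relations_of_eqOn_neg ((hL' i).1.trans (hL i).1.symm) fun z _ => by
      simp [(hL i).2, (hL' i).2, neg_div]
  have hsum : ∑ i, (of (L i) + of (L' i)) ∈ relations := sum_mem_relations _ _ fun i _ => hLi i
  have : -x - of Z' - ∑ i, of (L' i) =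
      -(x - of Z - ∑ i, of (L i)) - (of Z + of Z') - ∑ i, (of (L i) + of (L' i)) := by
    simp only [Finset.sum_add_distrib]
    abel
  rw [this]
  exact relations.sub_mem (relations.sub_mem (relations.neg_mem hx) hZ) hsum

/-- Relations are in normal form. [cite: KontsevichZagier2001, §1.2 rule (1)] -/
theorem nf_of_mem_relations {s : ℕ} {ε : Fin s → ℝ} (hεalg : ∀ i, IsAlgebraic ℚ (ε i))
    {x : FormalRep} (hx : x ∈ relations) :
    ∃ (r : ℝ) (C : Fin s → ℝ) (Z : IntegralRep 0) (L : Fin s → IntegralRep 1),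
      IsAlgebraic ℚ r ∧ (∀ i, IsAlgebraic ℚ (C i)) ∧ Z.domain = Set.univ ∧
      (Z.integrand = fun _ => r) ∧
      (∀ i, (L i).domain = {x : Fin 1 → ℝ | x 0 ∈ Set.Ioo 1 (ε i)} ∧
        ((L i).integrand = fun x => C i / x 0)) ∧
      x - of Z - ∑ i, of (L i) ∈ relations := by
  obtain ⟨Z, hZd, hZi⟩ := exists_ptA isAlgebraic_zero
  obtain ⟨L, hL⟩ := exists_carriers ε hεalg (fun _ => 0) fun _ => isAlgebraic_zero
  exact ⟨0, fun _ => 0, Z, L, isAlgebraic_zero, fun _ => isAlgebraic_zero, hZd, hZi, hL,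
    nf_data_of_mem_relations hx Z hZi L hL⟩

/-- Normal forms are invariant under congruence modulo relations: `NF(ε, x)` and
`y − x ∈ relations` give `NF(ε, y)`. [cite: KontsevichZagier2001, §1.2] -/
theorem nf_congr {s : ℕ} {ε : Fin s → ℝ} {x y : FormalRep}
    (h : ∃ (r : ℝ) (C : Fin s → ℝ) (Z : IntegralRep 0) (L : Fin s → IntegralRep 1),
      IsAlgebraic ℚ r ∧ (∀ i, IsAlgebraic ℚ (C i)) ∧ Z.domain = Set.univ ∧
      (Z.integrand = fun _ => r) ∧
      (∀ i, (L i).domain = {x : Fin 1 → ℝ | x 0 ∈ Set.Ioo 1 (ε i)} ∧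
        ((L i).integrand = fun x => C i / x 0)) ∧
      x - of Z - ∑ i, of (L i) ∈ relations)
    (hxy : y - x ∈ relations) :
    ∃ (r : ℝ) (C : Fin s → ℝ) (Z : IntegralRep 0) (L : Fin s → IntegralRep 1),
      IsAlgebraic ℚ r ∧ (∀ i, IsAlgebraic ℚ (C i)) ∧ Z.domain = Set.univ ∧
      (Z.integrand = fun _ => r) ∧
      (∀ i, (L i).domain = {x : Fin 1 → ℝ | x 0 ∈ Set.Ioo 1 (ε i)} ∧
        ((L i).integrand = fun x => C i / x 0)) ∧
      y - of Z - ∑ i, of (L i) ∈ relations := by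
  obtain ⟨r, C, Z, L, hr, hC, hZd, hZi, hL, hx⟩ := h
  refine ⟨r, C, Z, L, hr, hC, hZd, hZi, hL, ?_⟩
  have : y - of Z - ∑ i, of (L i) = (y - x) + (x - of Z - ∑ i, of (L i)) := by abel
  rw [this]
  exact relations.add_mem hxy hx

/-- Normal forms are closed under addition. [cite: KontsevichZagier2001, §1.2 rule (1)] -/
theorem nf_add {s : ℕ} {ε : Fin s → ℝ} (hεalg : ∀ i, IsAlgebraic ℚ (ε i)) {x y : FormalRep}
    (hx : ∃ (r : ℝ) (C : Fin s → ℝ) (Z : IntegralRep 0) (L : Fin s → IntegralRep 1),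
      IsAlgebraic ℚ r ∧ (∀ i, IsAlgebraic ℚ (C i)) ∧ Z.domain = Set.univ ∧
      (Z.integrand = fun _ => r) ∧
      (∀ i, (L i).domain = {x : Fin 1 → ℝ | x 0 ∈ Set.Ioo 1 (ε i)} ∧
        ((L i).integrand = fun x => C i / x 0)) ∧
      x - of Z - ∑ i, of (L i) ∈ relations)
    (hy : ∃ (r : ℝ) (C : Fin s → ℝ) (Z : IntegralRep 0) (L : Fin s → IntegralRep 1),
      IsAlgebraic ℚ r ∧ (∀ i, IsAlgebraic ℚ (C i)) ∧ Z.domain = Set.univ ∧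
      (Z.integrand = fun _ => r) ∧
      (∀ i, (L i).domain = {x : Fin 1 → ℝ | x 0 ∈ Set.Ioo 1 (ε i)} ∧
        ((L i).integrand = fun x => C i / x 0)) ∧
      y - of Z - ∑ i, of (L i) ∈ relations) :
    ∃ (r : ℝ) (C : Fin s → ℝ) (Z : IntegralRep 0) (L : Fin s → IntegralRep 1),
      IsAlgebraic ℚ r ∧ (∀ i, IsAlgebraic ℚ (C i)) ∧ Z.domain = Set.univ ∧
      (Z.integrand = fun _ => r) ∧
      (∀ i, (L i).domain = {x : Fin 1 → ℝ | x 0 ∈ Set.Ioo 1 (ε i)} ∧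
        ((L i).integrand = fun x => C i / x 0)) ∧
      x + y - of Z - ∑ i, of (L i) ∈ relations := by
  obtain ⟨r, C, Z, L, hr, hC, hZd, hZi, hL, hx⟩ := hx
  obtain ⟨r', C', Z', L', hr', hC', hZ'd, hZ'i, hL', hy⟩ := hy
  obtain ⟨Z'', hZ''d, hZ''i⟩ := exists_ptA (hr.add hr')
  obtain ⟨L'', hL''⟩ := exists_carriers ε hεalg (fun i => C i + C' i) fun i => (hC i).add (hC' i)
  exact ⟨r + r', fun i => C i + C' i, Z'', L'', hr.add hr', fun i => (hC i).add (hC' i), hZ''d,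
    hZ''i, hL'', nf_data_add Z Z' Z'' hZd hZi hZ'd hZ'i hZ''d hZ''i L L' L'' hL hL' hL'' hx hy⟩

/-- Normal forms are closed under negation. [cite: KontsevichZagier2001, §1.2 rule (1)] -/
theorem nf_neg {s : ℕ} {ε : Fin s → ℝ} (hεalg : ∀ i, IsAlgebraic ℚ (ε i)) {x : FormalRep}
    (hx : ∃ (r : ℝ) (C : Fin s → ℝ) (Z : IntegralRep 0) (L : Fin s → IntegralRep 1),
      IsAlgebraic ℚ r ∧ (∀ i, IsAlgebraic ℚ (C i)) ∧ Z.domain = Set.univ ∧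
      (Z.integrand = fun _ => r) ∧
      (∀ i, (L i).domain = {x : Fin 1 → ℝ | x 0 ∈ Set.Ioo 1 (ε i)} ∧
        ((L i).integrand = fun x => C i / x 0)) ∧
      x - of Z - ∑ i, of (L i) ∈ relations) :
    ∃ (r : ℝ) (C : Fin s → ℝ) (Z : IntegralRep 0) (L : Fin s → IntegralRep 1),
      IsAlgebraic ℚ r ∧ (∀ i, IsAlgebraic ℚ (C i)) ∧ Z.domain = Set.univ ∧
      (Z.integrand = fun _ => r) ∧
      (∀ i, (L i).domain = {x : Fin 1 → ℝ | x 0 ∈ Set.Ioo 1 (ε i)} ∧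
        ((L i).integrand = fun x => C i / x 0)) ∧
      -x - of Z - ∑ i, of (L i) ∈ relations := by
  obtain ⟨r, C, Z, L, hr, hC, hZd, hZi, hL, hx⟩ := hx
  obtain ⟨Z', hZ'd, hZ'i⟩ := exists_ptA hr.neg
  obtain ⟨L', hL'⟩ := exists_carriers ε hεalg (fun i => -C i) fun i => (hC i).neg
  exact ⟨-r, fun i => -C i, Z', L', hr.neg, fun i => (hC i).neg, hZ'd, hZ'i, hL',
    nf_data_neg Z Z' hZd hZi hZ'd hZ'i L L' hL hL' hx⟩

/-- Normal forms are closed under subtraction. [cite: KontsevichZagier2001, §1.2 rule (1)] -/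
theorem nf_sub {s : ℕ} {ε : Fin s → ℝ} (hεalg : ∀ i, IsAlgebraic ℚ (ε i)) {x y : FormalRep}
    (hx : ∃ (r : ℝ) (C : Fin s → ℝ) (Z : IntegralRep 0) (L : Fin s → IntegralRep 1),
      IsAlgebraic ℚ r ∧ (∀ i, IsAlgebraic ℚ (C i)) ∧ Z.domain = Set.univ ∧
      (Z.integrand = fun _ => r) ∧
      (∀ i, (L i).domain = {x : Fin 1 → ℝ | x 0 ∈ Set.Ioo 1 (ε i)} ∧
        ((L i).integrand = fun x => C i / x 0)) ∧
      x - of Z - ∑ i, of (L i) ∈ relations)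
    (hy : ∃ (r : ℝ) (C : Fin s → ℝ) (Z : IntegralRep 0) (L : Fin s → IntegralRep 1),
      IsAlgebraic ℚ r ∧ (∀ i, IsAlgebraic ℚ (C i)) ∧ Z.domain = Set.univ ∧
      (Z.integrand = fun _ => r) ∧
      (∀ i, (L i).domain = {x : Fin 1 → ℝ | x 0 ∈ Set.Ioo 1 (ε i)} ∧
        ((L i).integrand = fun x => C i / x 0)) ∧
      y - of Z - ∑ i, of (L i) ∈ relations) :
    ∃ (r : ℝ) (C : Fin s → ℝ) (Z : IntegralRep 0) (L : Fin s → IntegralRep 1),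
      IsAlgebraic ℚ r ∧ (∀ i, IsAlgebraic ℚ (C i)) ∧ Z.domain = Set.univ ∧
      (Z.integrand = fun _ => r) ∧
      (∀ i, (L i).domain = {x : Fin 1 → ℝ | x 0 ∈ Set.Ioo 1 (ε i)} ∧
        ((L i).integrand = fun x => C i / x 0)) ∧
      x - y - of Z - ∑ i, of (L i) ∈ relations := by
  rw [sub_eq_add_neg x y]
  exact nf_add hεalg hx (nf_neg hεalg hy)

/-- Normal forms are closed under finite sums. [cite: KontsevichZagier2001, §1.2 rule (1)] -/
theorem nf_sum {s : ℕ} {ε : Fin s → ℝ} (hεalg : ∀ i, IsAlgebraic ℚ (ε i)) {ι : Type*}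
    (t : Finset ι) (f : ι → FormalRep)
    (h : ∀ j ∈ t, ∃ (r : ℝ) (C : Fin s → ℝ) (Z : IntegralRep 0) (L : Fin s → IntegralRep 1),
      IsAlgebraic ℚ r ∧ (∀ i, IsAlgebraic ℚ (C i)) ∧ Z.domain = Set.univ ∧
      (Z.integrand = fun _ => r) ∧
      (∀ i, (L i).domain = {x : Fin 1 → ℝ | x 0 ∈ Set.Ioo 1 (ε i)} ∧
        ((L i).integrand = fun x => C i / x 0)) ∧
      f j - of Z - ∑ i, of (L i) ∈ relations) :
    ∃ (r : ℝ) (C : Fin s → ℝ) (Z : IntegralRep 0) (L : Fin s → IntegralRep 1),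
      IsAlgebraic ℚ r ∧ (∀ i, IsAlgebraic ℚ (C i)) ∧ Z.domain = Set.univ ∧
      (Z.integrand = fun _ => r) ∧
      (∀ i, (L i).domain = {x : Fin 1 → ℝ | x 0 ∈ Set.Ioo 1 (ε i)} ∧
        ((L i).integrand = fun x => C i / x 0)) ∧
      (∑ j ∈ t, f j) - of Z - ∑ i, of (L i) ∈ relations := by
  classical
  induction t using Finset.induction_on with
  | empty =>
    rw [Finset.sum_empty]
    exact nf_of_mem_relations hεalg relations.zero_mem
  | insert a t ha ih =>
    rw [Finset.sum_insert ha]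
    exact nf_add hεalg (h a (Finset.mem_insert_self a t))
      (ih fun j hj => h j (Finset.mem_insert_of_mem hj))

/-- Normal forms are closed under integer multiples. [cite: KontsevichZagier2001, §1.2 rule (1)] -/
theorem nf_zsmul {s : ℕ} {ε : Fin s → ℝ} (hεalg : ∀ i, IsAlgebraic ℚ (ε i)) {x : FormalRep}
    (hx : ∃ (r : ℝ) (C : Fin s → ℝ) (Z : IntegralRep 0) (L : Fin s → IntegralRep 1),
      IsAlgebraic ℚ r ∧ (∀ i, IsAlgebraic ℚ (C i)) ∧ Z.domain = Set.univ ∧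
      (Z.integrand = fun _ => r) ∧
      (∀ i, (L i).domain = {x : Fin 1 → ℝ | x 0 ∈ Set.Ioo 1 (ε i)} ∧
        ((L i).integrand = fun x => C i / x 0)) ∧
      x - of Z - ∑ i, of (L i) ∈ relations)
    (n : ℤ) :
    ∃ (r : ℝ) (C : Fin s → ℝ) (Z : IntegralRep 0) (L : Fin s → IntegralRep 1),
      IsAlgebraic ℚ r ∧ (∀ i, IsAlgebraic ℚ (C i)) ∧ Z.domain = Set.univ ∧
      (Z.integrand = fun _ => r) ∧
      (∀ i, (L i).domain = {x : Fin 1 → ℝ | x 0 ∈ Set.Ioo 1 (ε i)} ∧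
        ((L i).integrand = fun x => C i / x 0)) ∧
      n • x - of Z - ∑ i, of (L i) ∈ relations := by
  induction n using Int.induction_on with
  | zero =>
    rw [zero_zsmul]
    exact nf_of_mem_relations hεalg relations.zero_mem
  | succ k ih =>
    have : ((k:ℤ) + 1) • x = (k:ℤ) • x + x := by rw [add_zsmul, one_zsmul]
    rw [this]
    exact nf_add hεalg ih hx
  | pred k ih =>
    have : (-(k:ℤ) - 1) • x = (-(k:ℤ)) • x - x := by rw [sub_zsmul, one_zsmul, sub_eq_add_neg]
    rw [this]
    exact nf_sub hεalg ih hx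

/-! ## The normal form: basic members -/

/-- A point representation with algebraic constant is in normal form (all carriers zero).
[cite: KontsevichZagier2001, §1.2 rule (1)] -/
theorem nf_pt {s : ℕ} {ε : Fin s → ℝ} (hεalg : ∀ i, IsAlgebraic ℚ (ε i)) {r : ℝ}
    (hr : IsAlgebraic ℚ r) (Z : IntegralRep 0) (hZd : Z.domain = Set.univ)
    (hZi : Z.integrand = fun _ => r) :
    ∃ (r : ℝ) (C : Fin s → ℝ) (Z' : IntegralRep 0) (L : Fin s → IntegralRep 1),
      IsAlgebraic ℚ r ∧ (∀ i, IsAlgebraic ℚ (C i)) ∧ Z'.domain = Set.univ ∧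
      (Z'.integrand = fun _ => r) ∧
      (∀ i, (L i).domain = {x : Fin 1 → ℝ | x 0 ∈ Set.Ioo 1 (ε i)} ∧
        ((L i).integrand = fun x => C i / x 0)) ∧
      of Z - of Z' - ∑ i, of (L i) ∈ relations := by
  obtain ⟨L, hL⟩ := exists_carriers ε hεalg (fun _ => 0) fun _ => isAlgebraic_zero
  refine ⟨r, fun _ => 0, Z, L, hr, fun _ => isAlgebraic_zero, hZd, hZi, hL, ?_⟩
  rw [sub_self, zero_sub]
  exact relations.neg_mem (sum_mem_relations _ _ fun i _ => carrier_zero_mem_relations (L i) (hL i).2)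

/-- A basic carrier `Λ(εᵢ, c) = [(1, εᵢ), c/y]` with algebraic `c` is in normal form (the point part
zero, the other carriers zero). [cite: KontsevichZagier2001, §1.2 rule (1)] -/
theorem nf_carrier {s : ℕ} {ε : Fin s → ℝ} (hεalg : ∀ i, IsAlgebraic ℚ (ε i)) {c : ℝ}
    (hc : IsAlgebraic ℚ c) (i : Fin s) (M : IntegralRep 1)
    (hMd : M.domain = {x : Fin 1 → ℝ | x 0 ∈ Set.Ioo 1 (ε i)}) (hMi : M.integrand = fun x => c / x 0) :
    ∃ (r : ℝ) (C : Fin s → ℝ) (Z : IntegralRep 0) (L : Fin s → IntegralRep 1),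
      IsAlgebraic ℚ r ∧ (∀ i, IsAlgebraic ℚ (C i)) ∧ Z.domain = Set.univ ∧
      (Z.integrand = fun _ => r) ∧
      (∀ i, (L i).domain = {x : Fin 1 → ℝ | x 0 ∈ Set.Ioo 1 (ε i)} ∧
        ((L i).integrand = fun x => C i / x 0)) ∧
      of M - of Z - ∑ i, of (L i) ∈ relations := by
  classical
  obtain ⟨Z, hZd, hZi⟩ := exists_ptA isAlgebraic_zero
  have halg : ∀ j, IsAlgebraic ℚ ((Pi.single i c : Fin s → ℝ) j) := fun j => by
    rcases eq_or_ne j i with rfl | hj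
    · simpa using hc
    · simpa [hj] using isAlgebraic_zero
  obtain ⟨L, hL⟩ := exists_carriers ε hεalg (Pi.single i c) halg
  refine ⟨0, Pi.single i c, Z, L, isAlgebraic_zero, halg, hZd, hZi, hL, ?_⟩
  -- `of M − of (L i) ∈ relations` (congruence), the other carriers are zero
  have hMi' : of M - of (L i) ∈ relations :=
    dlogA_congr_mem_relations M (L i) hMd (hL i).1 (by rw [hMi]; exact fun _ _ => rfl)
      (by rw [(hL i).2]; exact fun x _ => by simp)
  have hrest : ∑ j ∈ Finset.univ.erase i, of (L j) ∈ relations :=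
    sum_mem_relations _ _ fun j hj => carrier_zero_mem_relations (L j) (by
      rw [(hL j).2]; simp [Pi.single_eq_of_ne (Finset.ne_of_mem_erase hj)])
  rw [← Finset.add_sum_erase _ _ (Finset.mem_univ i)]
  have : of M - of Z - (of (L i) + ∑ j ∈ Finset.univ.erase i, of (L j)) =
      (of M - of (L i)) - of Z - ∑ j ∈ Finset.univ.erase i, of (L j) := by abel
  rw [this]
  exact relations.sub_mem (relations.sub_mem hMi' (pt_zero_mem_relations Z hZi)) hrest

/-! ## The arithmetic endgame: a vanishing normal form is a relation (Baker) -/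

/-- **A normal form of value zero is a relation.** If `εᵢ > 1` are real algebraic with
`ℚ`-linearly independent logarithms, `x ≡ [pt, r] + Σᵢ Λ(εᵢ, Cᵢ)` with real algebraic `r, Cᵢ`, and
`eval x = 0`, then `x ∈ KZ.relations`: by soundness `eval x = r + Σ Cᵢ log εᵢ`, so Baker's theorem
(`Dlog.eq_zero_of_alg_add_sum_mul_log_eq_zero`) gives `r = 0` and all `Cᵢ = 0`, and representations
with zero integrand are relations. [cite: Baker1975, Theorem 2.1] -/
theorem mem_relations_of_nf_of_eval_eq_zero {s : ℕ} {ε : Fin s → ℝ} (hε1 : ∀ i, 1 < ε i)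
    (hεalg : ∀ i, IsAlgebraic ℚ (ε i)) (hli : LinearIndependent ℚ (fun i => Real.log (ε i)))
    {x : FormalRep}
    (hx : ∃ (r : ℝ) (C : Fin s → ℝ) (Z : IntegralRep 0) (L : Fin s → IntegralRep 1),
      IsAlgebraic ℚ r ∧ (∀ i, IsAlgebraic ℚ (C i)) ∧ Z.domain = Set.univ ∧
      (Z.integrand = fun _ => r) ∧
      (∀ i, (L i).domain = {x : Fin 1 → ℝ | x 0 ∈ Set.Ioo 1 (ε i)} ∧
        ((L i).integrand = fun x => C i / x 0)) ∧
      x - of Z - ∑ i, of (L i) ∈ relations)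
    (hx0 : eval x = 0) : x ∈ relations := by
  obtain ⟨r, C, Z, L, hr, hC, hZd, hZi, hL, hx⟩ := hx
  -- the value of the normal form
  have hval : eval (x - of Z - ∑ i, of (L i)) = 0 := relations_le_ker_eval_holds hx
  simp only [map_sub, map_sum, eval_of, hx0, zero_sub] at hval
  have hZv : Z.value = r := value_pt Z hZd hZi
  have hLv : ∀ i, (L i).value = C i * Real.log (ε i) := fun i => by
    rw [value_dlogA (L i) (hL i).1 (by rw [(hL i).2]; exact fun _ _ => rfl) one_pos (hε1 i).le,
      div_one]
  simp only [hZv, hLv] at hval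
  have hsum : r + ∑ i, C i * Real.log (ε i) = 0 := by linear_combination -hval
  obtain ⟨hr0, hC0⟩ := eq_zero_of_alg_add_sum_mul_log_eq_zero ε (fun i => lt_trans one_pos (hε1 i))
    hεalg hli r hr C hC hsum
  -- all data vanish: the pieces are relations
  have hZ0 : of Z ∈ relations := pt_zero_mem_relations Z (by rw [hZi, hr0])
  have hL0 : ∑ i, of (L i) ∈ relations :=
    sum_mem_relations _ _ fun i _ => carrier_zero_mem_relations (L i) (by rw [(hL i).2, hC0 i])
  have : x = (x - of Z - ∑ i, of (L i)) + of Z + ∑ i, of (L i) := by abel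
  rw [this]
  exact relations.add_mem (relations.add_mem hx hZ0) hL0

end AlgSplitK5

end Summit.KontsevichZagierPeriods.HurwitzMicroSectors.NormalFormPrinciple.PiBox
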